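import Literature.NumberTheory.Automorphic.UnitOrbitalIntegralSplitTorusHSide   -- ★ C′₂ (F0P3b-p01 (g6)): the template, its product plumbing ★ C′₁ `TorusDescentProd`, ★ C1 facts, ★ B′ `N = 2` data
import Literature.NumberTheory.Automorphic.TorusOrbitalDescentCanonical           -- ★ p842181 S0 FILE 1 (F0P3b-p01 (g7)): the explicit Iwasawa constant and the transported orbital integral
import Literature.NumberTheory.Automorphic.IwasawaIntegralProdCompactFactor  -- §1 of this brick: `integral_prod_prodBot_conj_eq_smul_integral_prod` (B-p18 (g32))
import HarnessLib

/-!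
# The CANONICAL orbital integral of `H_v = U(Φ₂)(L⁺_v) × U(Φ₁)(L⁺_v)` at a regular split-torus class, general test function, general Haar `ν_H`:
# `Φ_H(⟦(t, u)⟧, φ; m_H) = ((ν_H(K₂ × K₁) ∕ (κ₂(K₂) · μ_N(N₂ ∩ K₂))) · J_H(t)) · ∫_{K₂ × N₂} φ(k (t n) k⁻¹, u) d(κ₂ ⊗ μ_N)`
(Rogawski 1990 §4.9 p. 55, §4.13 p. 70 «`dg = dk dm du`», §4.3 (4.3.1) p. 43; Gelbart 1975 Thm. 9.22 (iii); Deitmar–Echterhoff 2014 Thm. 1.5.3)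

Topic `NumberTheory/Automorphic`; namespaces `Literature.NumberTheory.Automorphic` (§1, generic) and `….UnitaryGroup` (§2).  THEOREMS ONLY (no definition, no
instance, no notation, no named fact, no `sorry`).  Cell `pub/hodgecm-mathlib`, line «CMCharIdentityTest» (F0P3b `Cruxes/H413/Lines/F0_P3b_CMCharIdentityTestPaydown.lean`
ED. 12), desk F0P3b-plan (g12) PLAN v14 §10 brick **S0 FILE 2′ «H-SIDE CANONICAL ORBITAL INTEGRAL»** of (N-492) `stub_inducedCharTransfer` [Rogawski1990 Lemma 4.9.2]
(desk pin 2026-09-01T08:01:56Z: ARBITRARY Haar `ν_H` on `H_v`, constant through `ν_H(K₂ × U(Φ₁)_v)`; seat B-p18 (g32)).  This is ★ C′₂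
`classOrbitalIntegral_indicator_prod_eq_inv_sqrt_of_torus_regular_of_nonsplit` (F0P3b-p01 (g6): the unit `1_{K_H}`, `ν_H(K_H) = 1`) with `1_{K_H} ↦` a measurable
`φ`, `ν_H(K_H) = 1 ↦` any Haar `ν_H`, and the Iwasawa measures `κ`, `μ_N` of `K₂ × K₁`, `N₂ × 1` CHOSEN as the transports of the consumer's `κ₂ ⊗ κ₁`, `μ_{N₂}` —
read through ★ S0 FILE 1 `orbitalIntegral_centralizer_quotientMeasure_eq_smul_integral_of_mulEquiv` (p842181, Bochner, explicit constant) instead of ★ FILE B §2.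
* §1 (generic) `integral_prod_prodBot_conj_eq_smul_integral_prod` — on `A × U` with `U` ABELIAN, the `(K₂ × K₁) × (N × 1)` Iwasawa integral of `F(k (x n) k⁻¹)` against the
  transported `(κ₂ ⊗ κ₁) ⊗ μ_N` is `κ₁(K₁) • ∫_{K₂ × N} F(k₂ (x₁ n₂) k₂⁻¹, x₂) d(κ₂ ⊗ μ_N)` (conjugation is trivial in the `U`-coordinate; a measure identity —
  no integrability).
* §2 **`classOrbitalIntegral_prod_eq_smul_integral_prod_of_torus_regular_of_nonsplit`** — at a finite place `v` of `L⁺` with a place `w ∣ v` fixed by `c̄`, for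
  `m_H` CANONICAL for `(P_H, ν_H)` (★ `OrbitalMeasureFamily.IsCanonical`; `ν_H` ANY right-invariant Haar measure on `H_v`, `P_H` holding at the representative of the class),
  `K₁ = U(Φ₁)(L⁺_v)` (`hK₁`), `t = diag(d₀, d₁) ∈ T₂(L⁺_v)` REGULAR (`d₀⁻¹d₁ − 1` a unit; `IsRegularElt`), `u ∈ U(Φ₁)(L⁺_v)`, Haar `κ₂` on `K₂ = U(Φ₂)(𝒪_v)` and `μ_N` on `N₂`,
  measurable `φ : H_v → ℂ`:
  `classOrbitalIntegral m_H φ ⟦(t, u)⟧ = ((ν_H(K₂ × K₁) ∕ (κ₂(univ) · μ_N(N₂ ∩ K₂))) · J_H(t)).toReal • ∫_{K₂ × N₂} φ(k (t n) k⁻¹, u) d(κ₂ ⊗ μ_N)`,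
  `J_H(t) = χ⁻(d₀⁻¹d₁ − 1)⁻¹` the ★ B′ token (`= (√‖d₀⁻¹d₁ − 1‖)⁻¹`, ★ `twistModule_cmLocal_two_eq`).  The inner integral is the one of ★ S2
  `UnitaryGroup.exists_smoothTrace_cmPrincipalSeries_boxChar_eq_integral_torus` (p842291) token for token.
HONEST LABEL: HC_CM is proved only modulo the printed citations (2 remaining named inputs hLiu418, h413) until rung 0 closes; this file pays no letter by itself.

## References
* [Rogawski1990] J. D. Rogawski, *Automorphic Representations of Unitary Groups in Three Variables* (1990), §4.9 p. 55, Prop. 4.9.1 (b); §4.13 p. 70; §4.3 (4.3.1) p. 43.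
* [Gelbart1975] S. Gelbart, *Automorphic Forms on Adele Groups* (1975), Thm. 9.22 (iii).
* [DeitmarEchterhoff2014] A. Deitmar, S. Echterhoff, *Principles of Harmonic Analysis*, 2nd ed. (2014), Thm. 1.5.3.
-/

set_option autoImplicit false

noncomputable section

open MeasureTheory Measure Set Filter Topology NumberField IsDedekindDomain
open Literature.MeasureTheory.Group
open scoped ENNReal NNReal Matrix MatrixGroups

namespace Literature.NumberTheory.Automorphic


/-! ## §2 The CM instance: `H_v = U(Φ₂)(L⁺_v) × U(Φ₁)(L⁺_v)` at a non-split place, general `φ`, general Haar `ν_H` -/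

namespace UnitaryGroup

open Literature.NumberTheory.Rogawski1990 (IsRegularElt)
open Literature.NumberTheory.Automorphic.TorusDescentProd
open Literature.NumberTheory.Automorphic.UnitaryGroup.HeisRing Literature.NumberTheory.Automorphic.UnitaryGroup.LineRing

set_option maxHeartbeats 6400000 in
set_option synthInstance.maxHeartbeats 400000 in
-- instance-term unification on the CM local carriers (two spellings of `U(Φ₂)(L⁺_v)`), as in ★ C′₂
/-- **THE CANONICAL ORBITAL INTEGRAL OF `H_v = U(Φ₂)(L⁺_v) × U(Φ₁)(L⁺_v)` AT A REGULAR SPLIT-TORUS CLASS (non-split `v`), general test function, general Haar `ν_H`** —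
[Rogawski1990] §4.9 p. 55 ∕ §4.13 p. 70 «`dg = dk dm du`» with the compatible measures of §4.3 (4.3.1): for a CANONICAL orbital measure family `m_H` for `(P_H, ν_H)` on `H_v`
(`ν_H` ANY right-invariant Haar measure; `P_H` holding at the representative of the class), `K₁ = U(Φ₁)(L⁺_v)` (`hK₁`), `t = diag(d₀, d₁) ∈ T₂(L⁺_v)` REGULAR (`d₀⁻¹d₁ − 1`
a unit, `IsRegularElt`), `u ∈ U(Φ₁)(L⁺_v)`, Haar measures `κ₂` on `K₂ = U(Φ₂)(𝒪_v)` (★ `cmLocalIntegralLevel`) and `μ_N` on `N₂(L⁺_v)`, and a measurable `φ : H_v → ℂ`: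
`classOrbitalIntegral m_H φ ⟦(t, u)⟧ = ((ν_H(K₂ × K₁) ∕ (κ₂(univ) · μ_N(N₂ ∩ K₂))) · J_H(t)).toReal • ∫_{K₂ × N₂} φ (k (t n) k⁻¹, u) d(κ₂ ⊗ μ_N)`, `J_H(t) = χ⁻(d₀⁻¹d₁ − 1)⁻¹`
(★ B′; `= (√‖d₀⁻¹d₁ − 1‖)⁻¹` by ★ `twistModule_cmLocal_two_eq`).  Proof: ★ C′₂'s assembly (normalised torus measure `t_Z` on `Z(t, u) = T₂ × U(Φ₁)_v`, `compactCore Z ⊆ K₂ × K₁`,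
Gelbart's Iwasawa form on `(U(Φ₂)_v × U(Φ₁)_v) ⧸ (T₂ × U(Φ₁)_v)` with `K = K₂ × K₁`, `N = N₂ × 1`, the rank-one twist on `N₂ × 1`) read through ★ S0 FILE 1
`orbitalIntegral_centralizer_quotientMeasure_eq_smul_integral_of_mulEquiv` (p842181) along the re-spelling `Ψ`, with the Iwasawa measures `(κ₂ ⊗ κ₁)`-, `μ_N`-TRANSPORTED so that
§1 collapses the `K₁`-average (`κ₁(K₁)` cancels against `κ(univ) = κ₂(univ) κ₁(K₁)`).
[cite: Rogawski1990, §4.9 p. 55; §4.13 p. 70; §4.3 (4.3.1) p. 43] [cite: Gelbart1975, Thm. 9.22 (iii)] [cite: DeitmarEchterhoff2014, Thm. 1.5.3] -/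
theorem classOrbitalIntegral_prod_eq_smul_integral_prod_of_torus_regular_of_nonsplit
    (L : Type) [Field L] [NumberField L] [IsCMField L] {v : HeightOneSpectrum (𝓞 ↥(maximalRealSubfield L))}
    (w : PlacesOver L v) (hw : IsCMField.complexConj L • w.1 = w.1)
    [MeasurableSpace ((cmDatum L 2 (Matrix.of fun i j : Fin 2 => if i.val + j.val + 1 = 2 then (1 : L) else 0)).Local v × (cmDatum L 1 (Matrix.of fun i j : Fin 1 => if i.val + j.val + 1 = 1 then (1 : L) else 0)).Local v)] [BorelSpace ((cmDatum L 2 (Matrix.of fun i j : Fin 2 => if i.val + j.val + 1 = 2 then (1 : L) else 0)).Local v × (cmDatum L 1 (Matrix.of fun i j : Fin 1 => if i.val + j.val + 1 = 1 then (1 : L) else 0)).Local v)]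
    [∀ a : ((cmDatum L 2 (Matrix.of fun i j : Fin 2 => if i.val + j.val + 1 = 2 then (1 : L) else 0)).Local v × (cmDatum L 1 (Matrix.of fun i j : Fin 1 => if i.val + j.val + 1 = 1 then (1 : L) else 0)).Local v), MeasurableSpace (((cmDatum L 2 (Matrix.of fun i j : Fin 2 => if i.val + j.val + 1 = 2 then (1 : L) else 0)).Local v × (cmDatum L 1 (Matrix.of fun i j : Fin 1 => if i.val + j.val + 1 = 1 then (1 : L) else 0)).Local v) ⧸ Subgroup.centralizer ({a} : Set ((cmDatum L 2 (Matrix.of fun i j : Fin 2 => if i.val + j.val + 1 = 2 then (1 : L) else 0)).Local v × (cmDatum L 1 (Matrix.of fun i j : Fin 1 => if i.val + j.val + 1 = 1 then (1 : L) else 0)).Local v)))]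
    [∀ a : ((cmDatum L 2 (Matrix.of fun i j : Fin 2 => if i.val + j.val + 1 = 2 then (1 : L) else 0)).Local v × (cmDatum L 1 (Matrix.of fun i j : Fin 1 => if i.val + j.val + 1 = 1 then (1 : L) else 0)).Local v), BorelSpace (((cmDatum L 2 (Matrix.of fun i j : Fin 2 => if i.val + j.val + 1 = 2 then (1 : L) else 0)).Local v × (cmDatum L 1 (Matrix.of fun i j : Fin 1 => if i.val + j.val + 1 = 1 then (1 : L) else 0)).Local v) ⧸ Subgroup.centralizer ({a} : Set ((cmDatum L 2 (Matrix.of fun i j : Fin 2 => if i.val + j.val + 1 = 2 then (1 : L) else 0)).Local v × (cmDatum L 1 (Matrix.of fun i j : Fin 1 => if i.val + j.val + 1 = 1 then (1 : L) else 0)).Local v)))]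
    (νH : Measure ((cmDatum L 2 (Matrix.of fun i j : Fin 2 => if i.val + j.val + 1 = 2 then (1 : L) else 0)).Local v × (cmDatum L 1 (Matrix.of fun i j : Fin 1 => if i.val + j.val + 1 = 1 then (1 : L) else 0)).Local v)) [νH.IsHaarMeasure] [νH.IsMulRightInvariant]
    {P_H : ((cmDatum L 2 (Matrix.of fun i j : Fin 2 => if i.val + j.val + 1 = 2 then (1 : L) else 0)).Local v × (cmDatum L 1 (Matrix.of fun i j : Fin 1 => if i.val + j.val + 1 = 1 then (1 : L) else 0)).Local v) → Prop} {mH : OrbitalMeasureFamily ((cmDatum L 2 (Matrix.of fun i j : Fin 2 => if i.val + j.val + 1 = 2 then (1 : L) else 0)).Local v × (cmDatum L 1 (Matrix.of fun i j : Fin 1 => if i.val + j.val + 1 = 1 then (1 : L) else 0)).Local v)} (hmH : mH.IsCanonical P_H νH)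
    [MeasurableSpace ↥(unitaryGroupOfForm (conjLocal L (IsCMField.complexConj L) v) (cmLocalForm L 2 v))] [BorelSpace ↥(unitaryGroupOfForm (conjLocal L (IsCMField.complexConj L) v) (cmLocalForm L 2 v))]
    (K₂ : Subgroup ↥(unitaryGroupOfForm (conjLocal L (IsCMField.complexConj L) v) (cmLocalForm L 2 v))) (hK2 : K₂ = cmLocalIntegralLevel L 2 (Matrix.of fun i j : Fin 2 => if i.val + j.val + 1 = 2 then (1 : L) else 0) v)
    (κ₂ : Measure ↥K₂) [κ₂.IsHaarMeasure]
    (μN₂ : Measure ↥(cmBorelTriple L 2 v).N) [μN₂.IsHaarMeasure]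
    (t : ↥(cmBorelTriple L 2 v).M) {d : Fin 2 → (LocalRing L v)ˣ}
    (hd : glDiagonal 2 (LocalRing L v) d = ((t : ↥(unitaryGroupOfForm (conjLocal L (IsCMField.complexConj L) v) (cmLocalForm L 2 v))) : GL (Fin 2) (LocalRing L v)))
    (hb : IsUnit ((((d 0)⁻¹ * d 1 : (LocalRing L v)ˣ) : LocalRing L v) - 1))
    (hreg₂ : IsRegularElt ((t : ↥(unitaryGroupOfForm (conjLocal L (IsCMField.complexConj L) v) (cmLocalForm L 2 v))) : GL (Fin 2) (LocalRing L v)))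
    (u : (cmDatum L 1 (Matrix.of fun i j : Fin 1 => if i.val + j.val + 1 = 1 then (1 : L) else 0)).Local v) (hPH : P_H (Quotient.out (ConjClasses.mk (((t : ↥(unitaryGroupOfForm (conjLocal L (IsCMField.complexConj L) v) (cmLocalForm L 2 v))) : (cmDatum L 2 (Matrix.of fun i j : Fin 2 => if i.val + j.val + 1 = 2 then (1 : L) else 0)).Local v), u))))
    (hK₁ : ∀ x : (cmDatum L 1 (Matrix.of fun i j : Fin 1 => if i.val + j.val + 1 = 1 then (1 : L) else 0)).Local v, x ∈ cmLocalIntegralLevel L 1 (Matrix.of fun i j : Fin 1 => if i.val + j.val + 1 = 1 then (1 : L) else 0) v)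
    (φ : ((cmDatum L 2 (Matrix.of fun i j : Fin 2 => if i.val + j.val + 1 = 2 then (1 : L) else 0)).Local v × (cmDatum L 1 (Matrix.of fun i j : Fin 1 => if i.val + j.val + 1 = 1 then (1 : L) else 0)).Local v) → ℂ) (hφ : Measurable φ) :
    classOrbitalIntegral mH φ (ConjClasses.mk (((t : ↥(unitaryGroupOfForm (conjLocal L (IsCMField.complexConj L) v) (cmLocalForm L 2 v))) : (cmDatum L 2 (Matrix.of fun i j : Fin 2 => if i.val + j.val + 1 = 2 then (1 : L) else 0)).Local v), u)) =
      (νH ((((cmLocalIntegralLevel L 2 (Matrix.of fun i j : Fin 2 => if i.val + j.val + 1 = 2 then (1 : L) else 0) v).prod (cmLocalIntegralLevel L 1 (Matrix.of fun i j : Fin 1 => if i.val + j.val + 1 = 1 then (1 : L) else 0) v)) : Subgroup ((cmDatum L 2 (Matrix.of fun i j : Fin 2 => if i.val + j.val + 1 = 2 then (1 : L) else 0)).Local v × (cmDatum L 1 (Matrix.of fun i j : Fin 1 => if i.val + j.val + 1 = 1 then (1 : L) else 0)).Local v)) : Set ((cmDatum L 2 (Matrix.of fun i j : Fin 2 =>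 if i.val + j.val + 1 = 2 then (1 : L) else 0)).Local v × (cmDatum L 1 (Matrix.of fun i j : Fin 1 => if i.val + j.val + 1 = 1 then (1 : L) else 0)).Local v)) / (κ₂ Set.univ * μN₂ {n | (n : ↥(unitaryGroupOfForm (conjLocal L (IsCMField.complexConj L) v) (cmLocalForm L 2 v))) ∈ K₂}) *
          ((letI : MeasurableSpace (LocalRing L v) := borel _; haveI : BorelSpace (LocalRing L v) := ⟨rfl⟩
          haveI : SecondCountableTopology (LocalRing L v) := secondCountableTopology_localRing (E := L) v
          ((skewModulus (conjLocal L (IsCMField.complexConj L) v) (continuous_conjLocal L (IsCMField.complexConj L) v) hb.unit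
            (map_unit_torusScalar_sub_one_two (conjLocal L (IsCMField.complexConj L) v) (cmLocalForm_eq_over L 2 v)
              (⟨(t : ↥(unitaryGroupOfForm (conjLocal L (IsCMField.complexConj L) v) (cmLocalForm L 2 v))), t.2⟩ : ↥(torusU (conjLocal L (IsCMField.complexConj L) v) (cmLocalForm L 2 v))) hd hb))⁻¹ : ℝ≥0)) : ℝ≥0∞)).toReal •
        ∫ p : ↥K₂ × ↥(cmBorelTriple L 2 v).N,
          φ ((((p.1 : ↥(unitaryGroupOfForm (conjLocal L (IsCMField.complexConj L) v) (cmLocalForm L 2 v))) * ((t : ↥(unitaryGroupOfForm (conjLocal L (IsCMField.complexConj L) v) (cmLocalForm L 2 v))) * (p.2 : ↥(unitaryGroupOfForm (conjLocal L (IsCMField.complexConj L) v) (cmLocalForm L 2 v)))) * (p.1 : ↥(unitaryGroupOfForm (conjLocal L (IsCMField.complexConj L) v) (cmLocalForm L 2 v)))⁻¹ : ↥(unitaryGroupOfForm (conjLocal L (IsCMField.complexConj L) v) (cmLocalForm L 2 v))) : (cmDatum L 2 (Matrix.of fun i j : Fin 2 => if i.val + j.val + 1 = 2 then (1 : L) else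 0)).Local v), u) ∂(κ₂.prod μN₂) := by
  have hc := IsCMField.complexConj_ne_one L
  haveI : Algebra.IsQuadraticExtension ↥(maximalRealSubfield L) L := IsCMField.isQuadraticExtension L
  -- names for the representative
  set γ₂ : (cmDatum L 2 (Matrix.of fun i j : Fin 2 => if i.val + j.val + 1 = 2 then (1 : L) else 0)).Local v := ((t : ↥(unitaryGroupOfForm (conjLocal L (IsCMField.complexConj L) v) (cmLocalForm L 2 v))) : (cmDatum L 2 (Matrix.of fun i j : Fin 2 => if i.val + j.val + 1 = 2 then (1 : L) else 0)).Local v) with hγ₂def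
  set γ₁ : (cmDatum L 1 (Matrix.of fun i j : Fin 1 => if i.val + j.val + 1 = 1 then (1 : L) else 0)).Local v := u with hγ₁def
  have hd2 : glDiagonal 2 (LocalRing L v) d = ((γ₂).val : GL (Fin 2) (LocalRing L v)) := hd
  -- the frame of the quasi-split forms `Φ₂`, `Φ₁`
  have hΦ₂ := antidiagOne_map_transpose (IsCMField.complexConj L) 2
  have hΦ₁ := antidiagOne_map_transpose (IsCMField.complexConj L) 1
  have hΦ₂d : IsUnit (Matrix.of fun i j : Fin 2 => if i.val + j.val + 1 = 2 then (1 : L) else 0).det := by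
    have h : (Matrix.of fun i j : Fin 2 => if i.val + j.val + 1 = 2 then (1 : L) else 0) = !![0, 1; 1, 0] := by
      ext i j; fin_cases i <;> fin_cases j <;> rfl
    rw [h, Matrix.det_fin_two_of]; norm_num
  have hΦ₁d : IsUnit (Matrix.of fun i j : Fin 1 => if i.val + j.val + 1 = 1 then (1 : L) else 0).det := by
    rw [Matrix.det_fin_one, Matrix.of_apply]; norm_num
  have hreg₁ : IsRegularElt (γ₁.val : GL (Fin 1) (LocalRing L v)) := isRegularElt_of_fin_one _
  have hreg₂' : IsRegularElt ((γ₂).val : GL (Fin 2) (LocalRing L v)) := hreg₂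
  -- regularity of `diag(d)` in the all-pairs form, and at the place `w`
  have h10 : IsUnit ((d 1 : LocalRing L v) - d 0) := by
    have h := (d 0).isUnit.mul hb
    rwa [mul_sub, mul_one, Units.val_mul, Units.mul_inv_cancel_left] at h
  have hregd : ∀ i j : Fin 2, i ≠ j → IsUnit ((d i : LocalRing L v) - d j) := by
    intro i j hij
    fin_cases i <;> fin_cases j
    · exact absurd rfl hij
    · simpa using h10.neg
    · exact h10
    · exact absurd rfl hij
  have hdw : ∀ i j : Fin 2, i ≠ j → IsUnit (((d i : (LocalRing L v)ˣ) : LocalRing L v) w - ((d j : (LocalRing L v)ˣ) : LocalRing L v) w) := by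
    intro i j hij
    have h1 := (hregd i j hij).map (Pi.evalRingHom (fun w' : PlacesOver L v => w'.1.adicCompletion L) w)
    rwa [map_sub] at h1
  have hU := mul_comm_cmDatum_local_one L v
  -- Step 1: the normalised torus measure on `Z(γ_H)`; the class orbital integral at the representative
  haveI : IsClosed ((Subgroup.centralizer ({(γ₂, γ₁)} : Set ((cmDatum L 2 (Matrix.of fun i j : Fin 2 => if i.val + j.val + 1 = 2 then (1 : L) else 0)).Local v × (cmDatum L 1 (Matrix.of fun i j : Fin 1 => if i.val + j.val + 1 = 1 then (1 : L) else 0)).Local v)) : Subgroup ((cmDatum L 2 (Matrix.of fun i j : Fin 2 => if i.val + j.val + 1 = 2 then (1 : L) else 0)).Local v × (cmDatum L 1 (Matrix.of fun i j : Fin 1 => if i.val + j.val + 1 = 1 then (1 : L) else 0)).Local v)) : Set ((cmDatum L 2 (Matrix.of fun i j : Fin 2 => if i.val + j.val + 1 = 2 then (1 : L) else 0)).Local v × (cmDatum L 1 (Matrix.of fun i j : Fin 1 => if i.val + j.val + 1 = 1 then (1 : L) else 0)).Local v)) := isClosed_coe_centralizer_singleton _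
  haveI : BorelSpace ↥(Subgroup.centralizer ({(γ₂, γ₁)} : Set ((cmDatum L 2 (Matrix.of fun i j : Fin 2 => if i.val + j.val + 1 = 2 then (1 : L) else 0)).Local v × (cmDatum L 1 (Matrix.of fun i j : Fin 1 => if i.val + j.val + 1 = 1 then (1 : L) else 0)).Local v))) := Subtype.borelSpace _
  haveI : SecondCountableTopology ↥(Subgroup.centralizer ({(γ₂, γ₁)} : Set ((cmDatum L 2 (Matrix.of fun i j : Fin 2 => if i.val + j.val + 1 = 2 then (1 : L) else 0)).Local v × (cmDatum L 1 (Matrix.of fun i j : Fin 1 => if i.val + j.val + 1 = 1 then (1 : L) else 0)).Local v))) := TopologicalSpace.Subtype.secondCountableTopology _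
  haveI : LocallyCompactSpace ↥(Subgroup.centralizer ({(γ₂, γ₁)} : Set ((cmDatum L 2 (Matrix.of fun i j : Fin 2 => if i.val + j.val + 1 = 2 then (1 : L) else 0)).Local v × (cmDatum L 1 (Matrix.of fun i j : Fin 1 => if i.val + j.val + 1 = 1 then (1 : L) else 0)).Local v))) :=
    (isClosed_coe_centralizer_singleton (γ₂, γ₁)).isClosedEmbedding_subtypeVal.locallyCompactSpace
  have f₂ := compactCore_centralizer_local_facts_of_isRegularElt (IsCMField.complexConj L) 2 _ hc hΦ₂ hΦ₂d γ₂ hreg₂'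
  have f₁ := compactCore_centralizer_local_facts_of_isRegularElt (IsCMField.complexConj L) 1 _ hc hΦ₁ hΦ₁d γ₁ hreg₁
  obtain ⟨tZ, htZ, htZi, htZ1⟩ :
      ∃ t' : Measure ↥(Subgroup.centralizer ({(γ₂, γ₁)} : Set ((cmDatum L 2 (Matrix.of fun i j : Fin 2 => if i.val + j.val + 1 = 2 then (1 : L) else 0)).Local v × (cmDatum L 1 (Matrix.of fun i j : Fin 1 => if i.val + j.val + 1 = 1 then (1 : L) else 0)).Local v))), t'.IsHaarMeasure ∧ t'.IsInvInvariant ∧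
        t' (compactCore ↥(Subgroup.centralizer ({(γ₂, γ₁)} : Set ((cmDatum L 2 (Matrix.of fun i j : Fin 2 => if i.val + j.val + 1 = 2 then (1 : L) else 0)).Local v × (cmDatum L 1 (Matrix.of fun i j : Fin 1 => if i.val + j.val + 1 = 1 then (1 : L) else 0)).Local v)))) = 1 := by
    refine exists_isHaarMeasure_compactCore_centralizer_prod_eq_one (A := (cmDatum L 2 (Matrix.of fun i j : Fin 2 => if i.val + j.val + 1 = 2 then (1 : L) else 0)).Local v) (B := (cmDatum L 1 (Matrix.of fun i j : Fin 1 => if i.val + j.val + 1 = 1 then (1 : L) else 0)).Local v) γ₂ γ₁ ?_ ?_ ?_ ?_ ?_ ?_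
    · exact f₂.1
    · exact f₁.1
    · exact f₂.2.1
    · exact f₂.2.2
    · exact f₁.2.1
    · exact f₁.2.2
  haveI := htZ
  haveI := htZi
  have hKHco := isCompact_isOpen_cmLocalIntegralLevel_prod L 2 1 (Matrix.of fun i j : Fin 2 => if i.val + j.val + 1 = 2 then (1 : L) else 0) (Matrix.of fun i j : Fin 1 => if i.val + j.val + 1 = 1 then (1 : L) else 0) v
  rw [hmH.classOrbitalIntegral_mk_eq_orbitalIntegral hPH tZ htZ1]
  -- `compactCore Z(γ_H) ⊆ K_H`: compact subgroups of `Z(γ₂)` are integral at `w` (★ C1) — verbatim ★ C′₂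
  have hZ' : ∀ g : ((cmDatum L 2 (Matrix.of fun i j : Fin 2 => if i.val + j.val + 1 = 2 then (1 : L) else 0)).Local v × (cmDatum L 1 (Matrix.of fun i j : Fin 1 => if i.val + j.val + 1 = 1 then (1 : L) else 0)).Local v), g ∈ Subgroup.centralizer ({(γ₂, γ₁)} : Set ((cmDatum L 2 (Matrix.of fun i j : Fin 2 => if i.val + j.val + 1 = 2 then (1 : L) else 0)).Local v × (cmDatum L 1 (Matrix.of fun i j : Fin 1 => if i.val + j.val + 1 = 1 then (1 : L) else 0)).Local v)) ↔ g.1 ∈ Subgroup.centralizer ({γ₂} : Set ((cmDatum L 2 (Matrix.of fun i j : Fin 2 => if i.val + j.val + 1 = 2 then (1 : L) else 0)).Local v)) := by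
    intro g
    rw [Subgroup.mem_centralizer_singleton_iff, Subgroup.mem_centralizer_singleton_iff, Prod.ext_iff, Prod.fst_mul, Prod.fst_mul, Prod.snd_mul, Prod.snd_mul]
    exact ⟨fun h => h.1, fun h => ⟨h, hU _ _⟩⟩
  have hγ₂w : (((localNonsplitEquiv (IsCMField.complexConj L) (Matrix.of fun i j : Fin 2 => if i.val + j.val + 1 = 2 then (1 : L) else 0) hc w hw γ₂ :
        ↥(unitaryGroupOfForm (galAdicCompletionMap (L := L) (IsCMField.complexConj L) hw) (placeForm (Matrix.of fun i j : Fin 2 => if i.val + j.val + 1 = 2 then (1 : L) else 0) w.1))) :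
        GL (Fin 2) (w.1.adicCompletion L)) : Matrix (Fin 2) (Fin 2) (w.1.adicCompletion L)) =
      Matrix.diagonal fun i => ((d i : (LocalRing L v)ˣ) : LocalRing L v) w := by
    rw [coe_coe_localNonsplitEquiv_apply, ← hd2, coe_glDiagonal,
      Matrix.diagonal_map (RingHom.map_zero (Pi.evalRingHom (fun w' : PlacesOver L v => w'.1.adicCompletion L) w))]
    rfl
  have hint : ∀ C' : Subgroup ((cmDatum L 2 (Matrix.of fun i j : Fin 2 => if i.val + j.val + 1 = 2 then (1 : L) else 0)).Local v), IsCompact (C' : Set ((cmDatum L 2 (Matrix.of fun i j : Fin 2 => if i.val + j.val + 1 = 2 then (1 : L) else 0)).Local v)) →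
      C' ≤ Subgroup.centralizer ({γ₂} : Set ((cmDatum L 2 (Matrix.of fun i j : Fin 2 => if i.val + j.val + 1 = 2 then (1 : L) else 0)).Local v)) → C' ≤ cmLocalIntegralLevel L 2 (Matrix.of fun i j : Fin 2 => if i.val + j.val + 1 = 2 then (1 : L) else 0) v := by
    intro C' hC' hC'Z c hcC
    let φ' : ((cmDatum L 2 (Matrix.of fun i j : Fin 2 => if i.val + j.val + 1 = 2 then (1 : L) else 0)).Local v) →* GL (Fin 2) (w.1.adicCompletion L) :=
      (unitaryGroupOfForm (galAdicCompletionMap (L := L) (IsCMField.complexConj L) hw) (placeForm (Matrix.of fun i j : Fin 2 => if i.val + j.val + 1 = 2 then (1 : L) else 0) w.1)).subtype.comp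
        (localNonsplitEquiv (IsCMField.complexConj L) (Matrix.of fun i j : Fin 2 => if i.val + j.val + 1 = 2 then (1 : L) else 0) hc w hw).toMulEquiv.toMonoidHom
    have hφ' : Continuous φ' := continuous_subtype_val.comp (localNonsplitEquiv (IsCMField.complexConj L) (Matrix.of fun i j : Fin 2 => if i.val + j.val + 1 = 2 then (1 : L) else 0) hc w hw).continuous
    have hCc : IsCompact ((C'.map φ' : Subgroup (GL (Fin 2) (w.1.adicCompletion L))) : Set (GL (Fin 2) (w.1.adicCompletion L))) := by
      rw [Subgroup.coe_map]; exact hC'.image hφ'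
    have hCZ : C'.map φ' ≤ Subgroup.centralizer ({φ' γ₂} : Set (GL (Fin 2) (w.1.adicCompletion L))) := by
      rintro _ ⟨x, hx, rfl⟩
      rw [Subgroup.mem_centralizer_singleton_iff, ← map_mul, ← map_mul, Subgroup.mem_centralizer_singleton_iff.1 (hC'Z hx)]
    have hle := subgroup_le_glInt_of_isCompact_of_le_centralizer_diagonal 2 (w.1) hγ₂w hdw _ hCc hCZ
    exact (mem_localIntegralLevel_iff_of_smul_eq (IsCMField.complexConj L) 2 _ hc w hw c).2 (hle ⟨c, hcC, rfl⟩)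
  have hcore := compactCore_subset_preimage_prod (K₁ := cmLocalIntegralLevel L 1 (Matrix.of fun i j : Fin 1 => if i.val + j.val + 1 = 1 then (1 : L) else 0) v) hZ' hint hK₁
  -- Step 2: the re-spelled product `G = U(Φ₂)(L⁺_v) × U(Φ₁)(L⁺_v)` and `Ψ : H_v ≃ G`
  let Ψ : ((cmDatum L 2 (Matrix.of fun i j : Fin 2 => if i.val + j.val + 1 = 2 then (1 : L) else 0)).Local v × (cmDatum L 1 (Matrix.of fun i j : Fin 1 => if i.val + j.val + 1 = 1 then (1 : L) else 0)).Local v) ≃* ↥(unitaryGroupOfForm (conjLocal L (IsCMField.complexConj L) v) (cmLocalForm L 2 v)) × (cmDatum L 1 (Matrix.of fun i j : Fin 1 => if i.val + j.val + 1 = 1 then (1 : L) else 0)).Local v :=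
    { toFun := fun g => (⟨g.1.val, g.1.property⟩, g.2)
      invFun := fun g => (⟨g.1.val, g.1.property⟩, g.2)
      left_inv := fun _ => rfl
      right_inv := fun _ => rfl
      map_mul' := fun _ _ => rfl }
  have hΨ : Continuous Ψ := ((continuous_subtype_val.comp continuous_fst).subtype_mk _).prodMk continuous_snd
  have hΨs : Continuous Ψ.symm := ((continuous_subtype_val.comp continuous_fst).subtype_mk _).prodMk continuous_snd
  have hΨ2 : ∀ g : ((cmDatum L 2 (Matrix.of fun i j : Fin 2 => if i.val + j.val + 1 = 2 then (1 : L) else 0)).Local v × (cmDatum L 1 (Matrix.of fun i j : Fin 1 => if i.val + j.val + 1 = 1 then (1 : L) else 0)).Local v), (Ψ g).2 = g.2 := fun _ => rfl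
  set t₂ : ↥(unitaryGroupOfForm (conjLocal L (IsCMField.complexConj L) v) (cmLocalForm L 2 v)) := (Ψ (γ₂, γ₁)).1 with ht₂def
  have ht₂ : t₂ ∈ (torusU (conjLocal L (IsCMField.complexConj L) v) (cmLocalForm L 2 v)) := ⟨d, hd⟩
  have hdt : glDiagonal 2 (LocalRing L v) d = (t₂ : GL (Fin 2) (LocalRing L v)) := hd
  letI mH1 : MeasurableSpace ((cmDatum L 1 (Matrix.of fun i j : Fin 1 => if i.val + j.val + 1 = 1 then (1 : L) else 0)).Local v) := borel _
  haveI : BorelSpace ((cmDatum L 1 (Matrix.of fun i j : Fin 1 => if i.val + j.val + 1 = 1 then (1 : L) else 0)).Local v) := ⟨rfl⟩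
  haveI : BorelSpace (↥(unitaryGroupOfForm (conjLocal L (IsCMField.complexConj L) v) (cmLocalForm L 2 v)) × (cmDatum L 1 (Matrix.of fun i j : Fin 1 => if i.val + j.val + 1 = 1 then (1 : L) else 0)).Local v) := Prod.borelSpace
  haveI : LocallyCompactSpace ↥(unitaryGroupOfForm (conjLocal L (IsCMField.complexConj L) v) (cmLocalForm L 2 v)) := locallyCompactSpace_local (IsCMField.complexConj L) 2 _ v
  haveI : SecondCountableTopology ↥(unitaryGroupOfForm (conjLocal L (IsCMField.complexConj L) v) (cmLocalForm L 2 v)) := secondCountableTopology_local (IsCMField.complexConj L) 2 _ v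
  letI mQ : MeasurableSpace ((↥(unitaryGroupOfForm (conjLocal L (IsCMField.complexConj L) v) (cmLocalForm L 2 v)) × (cmDatum L 1 (Matrix.of fun i j : Fin 1 => if i.val + j.val + 1 = 1 then (1 : L) else 0)).Local v) ⧸ ((torusU (conjLocal L (IsCMField.complexConj L) v) (cmLocalForm L 2 v)).prod (⊤ : Subgroup ((cmDatum L 1 (Matrix.of fun i j : Fin 1 => if i.val + j.val + 1 = 1 then (1 : L) else 0)).Local v)))) := borel _
  haveI : BorelSpace ((↥(unitaryGroupOfForm (conjLocal L (IsCMField.complexConj L) v) (cmLocalForm L 2 v)) × (cmDatum L 1 (Matrix.of fun i j : Fin 1 => if i.val + j.val + 1 = 1 then (1 : L) else 0)).Local v) ⧸ ((torusU (conjLocal L (IsCMField.complexConj L) v) (cmLocalForm L 2 v)).prod (⊤ : Subgroup ((cmDatum L 1 (Matrix.of fun i j : Fin 1 => if i.val + j.val + 1 = 1 then (1 : L) else 0)).Local v)))) := ⟨rfl⟩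
  -- the subgroups `T = T₂ × U`, `N = N₂ × 1`, `B = B₂ × U`, `K = K₂ × K₁` of `G`
  have hK2co : IsCompact (K₂ : Set ↥(unitaryGroupOfForm (conjLocal L (IsCMField.complexConj L) v) (cmLocalForm L 2 v))) ∧ IsOpen (K₂ : Set ↥(unitaryGroupOfForm (conjLocal L (IsCMField.complexConj L) v) (cmLocalForm L 2 v))) := by
    rw [hK2]; exact isCompact_isOpen_cmLocalIntegralLevel L 2 (Matrix.of fun i j : Fin 2 => if i.val + j.val + 1 = 2 then (1 : L) else 0) v
  have hK1co := isCompact_isOpen_cmLocalIntegralLevel L 1 (Matrix.of fun i j : Fin 1 => if i.val + j.val + 1 = 1 then (1 : L) else 0) v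
  have hKco : IsCompact ((((K₂.prod (cmLocalIntegralLevel L 1 (Matrix.of fun i j : Fin 1 => if i.val + j.val + 1 = 1 then (1 : L) else 0) v))) : Subgroup (↥(unitaryGroupOfForm (conjLocal L (IsCMField.complexConj L) v) (cmLocalForm L 2 v)) × (cmDatum L 1 (Matrix.of fun i j : Fin 1 => if i.val + j.val + 1 = 1 then (1 : L) else 0)).Local v)) : Set (↥(unitaryGroupOfForm (conjLocal L (IsCMField.complexConj L) v) (cmLocalForm L 2 v)) × (cmDatum L 1 (Matrix.of fun i j : Fin 1 => if i.val + j.val + 1 = 1 then (1 : L) else 0)).Local v)) ∧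
      IsOpen ((((K₂.prod (cmLocalIntegralLevel L 1 (Matrix.of fun i j : Fin 1 => if i.val + j.val + 1 = 1 then (1 : L) else 0) v))) : Subgroup (↥(unitaryGroupOfForm (conjLocal L (IsCMField.complexConj L) v) (cmLocalForm L 2 v)) × (cmDatum L 1 (Matrix.of fun i j : Fin 1 => if i.val + j.val + 1 = 1 then (1 : L) else 0)).Local v)) : Set (↥(unitaryGroupOfForm (conjLocal L (IsCMField.complexConj L) v) (cmLocalForm L 2 v)) × (cmDatum L 1 (Matrix.of fun i j : Fin 1 => if i.val + j.val + 1 = 1 then (1 : L) else 0)).Local v)) := by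
    rw [Subgroup.coe_prod]; exact ⟨hK2co.1.prod hK1co.1, hK2co.2.prod hK1co.2⟩
  have hZ : ∀ g : ↥(unitaryGroupOfForm (conjLocal L (IsCMField.complexConj L) v) (cmLocalForm L 2 v)) × (cmDatum L 1 (Matrix.of fun i j : Fin 1 => if i.val + j.val + 1 = 1 then (1 : L) else 0)).Local v, g ∈ ((torusU (conjLocal L (IsCMField.complexConj L) v) (cmLocalForm L 2 v)).prod (⊤ : Subgroup ((cmDatum L 1 (Matrix.of fun i j : Fin 1 => if i.val + j.val + 1 = 1 then (1 : L) else 0)).Local v))) ↔ g.1 ∈ (torusU (conjLocal L (IsCMField.complexConj L) v) (cmLocalForm L 2 v)) := fun g => by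
    rw [Subgroup.mem_prod]; exact ⟨fun h => h.1, fun h => ⟨h, Subgroup.mem_top _⟩⟩
  have hT₂ : IsClosed (((torusU (conjLocal L (IsCMField.complexConj L) v) (cmLocalForm L 2 v))) : Set ↥(unitaryGroupOfForm (conjLocal L (IsCMField.complexConj L) v) (cmLocalForm L 2 v))) := isClosed_torusU_two _ _
  have hN₂ : IsClosed (((unipotentU (conjLocal L (IsCMField.complexConj L) v) (cmLocalForm L 2 v))) : Set ↥(unitaryGroupOfForm (conjLocal L (IsCMField.complexConj L) v) (cmLocalForm L 2 v))) := isClosed_unipotentU _ _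
  have hT : IsClosed (((((torusU (conjLocal L (IsCMField.complexConj L) v) (cmLocalForm L 2 v)).prod (⊤ : Subgroup ((cmDatum L 1 (Matrix.of fun i j : Fin 1 => if i.val + j.val + 1 = 1 then (1 : L) else 0)).Local v)))) : Subgroup (↥(unitaryGroupOfForm (conjLocal L (IsCMField.complexConj L) v) (cmLocalForm L 2 v)) × (cmDatum L 1 (Matrix.of fun i j : Fin 1 => if i.val + j.val + 1 = 1 then (1 : L) else 0)).Local v)) : Set (↥(unitaryGroupOfForm (conjLocal L (IsCMField.complexConj L) v) (cmLocalForm L 2 v)) × (cmDatum L 1 (Matrix.of fun i j : Fin 1 => if i.val + j.val + 1 = 1 then (1 : L) else 0)).Local v)) :=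
    isClosed_coe_prod _ _ hT₂ (by rw [Subgroup.coe_top]; exact isClosed_univ)
  have hB : IsClosed (((((borelU (conjLocal L (IsCMField.complexConj L) v) (cmLocalForm L 2 v)).prod (⊤ : Subgroup ((cmDatum L 1 (Matrix.of fun i j : Fin 1 => if i.val + j.val + 1 = 1 then (1 : L) else 0)).Local v)))) : Subgroup (↥(unitaryGroupOfForm (conjLocal L (IsCMField.complexConj L) v) (cmLocalForm L 2 v)) × (cmDatum L 1 (Matrix.of fun i j : Fin 1 => if i.val + j.val + 1 = 1 then (1 : L) else 0)).Local v)) : Set (↥(unitaryGroupOfForm (conjLocal L (IsCMField.complexConj L) v) (cmLocalForm L 2 v)) × (cmDatum L 1 (Matrix.of fun i j : Fin 1 => if i.val + j.val + 1 = 1 then (1 : L) else 0)).Local v)) :=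
    isClosed_coe_prod _ _ (isClosed_borelU _ _) (by rw [Subgroup.coe_top]; exact isClosed_univ)
  have hNc : IsClosed (((((unipotentU (conjLocal L (IsCMField.complexConj L) v) (cmLocalForm L 2 v)).prod (⊥ : Subgroup ((cmDatum L 1 (Matrix.of fun i j : Fin 1 => if i.val + j.val + 1 = 1 then (1 : L) else 0)).Local v)))) : Subgroup (↥(unitaryGroupOfForm (conjLocal L (IsCMField.complexConj L) v) (cmLocalForm L 2 v)) × (cmDatum L 1 (Matrix.of fun i j : Fin 1 => if i.val + j.val + 1 = 1 then (1 : L) else 0)).Local v)) : Set (↥(unitaryGroupOfForm (conjLocal L (IsCMField.complexConj L) v) (cmLocalForm L 2 v)) × (cmDatum L 1 (Matrix.of fun i j : Fin 1 => if i.val + j.val + 1 = 1 then (1 : L) else 0)).Local v)) :=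
    isClosed_coe_prod _ _ hN₂ (by rw [Subgroup.coe_bot]; exact isClosed_singleton)
  haveI : LocallyCompactSpace ↥((torusU (conjLocal L (IsCMField.complexConj L) v) (cmLocalForm L 2 v)).prod (⊤ : Subgroup ((cmDatum L 1 (Matrix.of fun i j : Fin 1 => if i.val + j.val + 1 = 1 then (1 : L) else 0)).Local v))) := hT.isClosedEmbedding_subtypeVal.locallyCompactSpace
  haveI : SecondCountableTopology ↥((torusU (conjLocal L (IsCMField.complexConj L) v) (cmLocalForm L 2 v)).prod (⊤ : Subgroup ((cmDatum L 1 (Matrix.of fun i j : Fin 1 => if i.val + j.val + 1 = 1 then (1 : L) else 0)).Local v))) := TopologicalSpace.Subtype.secondCountableTopology _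
  haveI : LocallyCompactSpace ↥((unipotentU (conjLocal L (IsCMField.complexConj L) v) (cmLocalForm L 2 v)).prod (⊥ : Subgroup ((cmDatum L 1 (Matrix.of fun i j : Fin 1 => if i.val + j.val + 1 = 1 then (1 : L) else 0)).Local v))) := hNc.isClosedEmbedding_subtypeVal.locallyCompactSpace
  haveI : SecondCountableTopology ↥((unipotentU (conjLocal L (IsCMField.complexConj L) v) (cmLocalForm L 2 v)).prod (⊥ : Subgroup ((cmDatum L 1 (Matrix.of fun i j : Fin 1 => if i.val + j.val + 1 = 1 then (1 : L) else 0)).Local v))) := TopologicalSpace.Subtype.secondCountableTopology _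
  haveI : LocallyCompactSpace ↥(((K₂.prod (cmLocalIntegralLevel L 1 (Matrix.of fun i j : Fin 1 => if i.val + j.val + 1 = 1 then (1 : L) else 0) v))) : Subgroup (↥(unitaryGroupOfForm (conjLocal L (IsCMField.complexConj L) v) (cmLocalForm L 2 v)) × (cmDatum L 1 (Matrix.of fun i j : Fin 1 => if i.val + j.val + 1 = 1 then (1 : L) else 0)).Local v)) := hKco.1.isClosed.isClosedEmbedding_subtypeVal.locallyCompactSpace
  haveI : SecondCountableTopology ↥(((K₂.prod (cmLocalIntegralLevel L 1 (Matrix.of fun i j : Fin 1 => if i.val + j.val + 1 = 1 then (1 : L) else 0) v))) : Subgroup (↥(unitaryGroupOfForm (conjLocal L (IsCMField.complexConj L) v) (cmLocalForm L 2 v)) × (cmDatum L 1 (Matrix.of fun i j : Fin 1 => if i.val + j.val + 1 = 1 then (1 : L) else 0)).Local v)) := TopologicalSpace.Subtype.secondCountableTopology _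
  haveI : LocallyCompactSpace ↥K₂ := hK2co.1.isClosed.isClosedEmbedding_subtypeVal.locallyCompactSpace
  haveI : SecondCountableTopology ↥K₂ := TopologicalSpace.Subtype.secondCountableTopology _
  haveI : CompactSpace ↥K₂ := isCompact_iff_compactSpace.1 hK2co.1
  haveI : LocallyCompactSpace ↥(cmLocalIntegralLevel L 1 (Matrix.of fun i j : Fin 1 => if i.val + j.val + 1 = 1 then (1 : L) else 0) v) := hK1co.1.isClosed.isClosedEmbedding_subtypeVal.locallyCompactSpace
  haveI : SecondCountableTopology ↥(cmLocalIntegralLevel L 1 (Matrix.of fun i j : Fin 1 => if i.val + j.val + 1 = 1 then (1 : L) else 0) v) := TopologicalSpace.Subtype.secondCountableTopology _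
  haveI : CompactSpace ↥(cmLocalIntegralLevel L 1 (Matrix.of fun i j : Fin 1 => if i.val + j.val + 1 = 1 then (1 : L) else 0) v) := isCompact_iff_compactSpace.1 hK1co.1
  haveI : LocallyCompactSpace ↥(cmBorelTriple L 2 v).N := hN₂.isClosedEmbedding_subtypeVal.locallyCompactSpace
  haveI : SecondCountableTopology ↥(cmBorelTriple L 2 v).N := TopologicalSpace.Subtype.secondCountableTopology _
  haveI : SigmaCompactSpace ↥(cmBorelTriple L 2 v).N := sigmaCompactSpace_of_locallyCompact_secondCountable
  haveI : SigmaFinite μN₂ := inferInstance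
  haveI : LocallyCompactSpace ((cmDatum L 1 (Matrix.of fun i j : Fin 1 => if i.val + j.val + 1 = 1 then (1 : L) else 0)).Local v) := locallyCompactSpace_local (IsCMField.complexConj L) 1 _ v
  haveI : SecondCountableTopology ((cmDatum L 1 (Matrix.of fun i j : Fin 1 => if i.val + j.val + 1 = 1 then (1 : L) else 0)).Local v) := secondCountableTopology_local (IsCMField.complexConj L) 1 _ v
  -- `Ψ Z(γ_H) = T`
  have hZT : ∀ g : ((cmDatum L 2 (Matrix.of fun i j : Fin 2 => if i.val + j.val + 1 = 2 then (1 : L) else 0)).Local v × (cmDatum L 1 (Matrix.of fun i j : Fin 1 => if i.val + j.val + 1 = 1 then (1 : L) else 0)).Local v), Ψ g ∈ ((torusU (conjLocal L (IsCMField.complexConj L) v) (cmLocalForm L 2 v)).prod (⊤ : Subgroup ((cmDatum L 1 (Matrix.of fun i j : Fin 1 => if i.val + j.val + 1 = 1 then (1 : L) else 0)).Local v))) ↔ g ∈ Subgroup.centralizer ({(γ₂, γ₁)} : Set ((cmDatum L 2 (Matrix.of fun i j : Fin 2 => if i.val + j.val + 1 = 2 then (1 : L) else 0)).Local v × (cmDatum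 L 1 (Matrix.of fun i j : Fin 1 => if i.val + j.val + 1 = 1 then (1 : L) else 0)).Local v)) := by
    intro g
    rw [hZ, hZ', mem_torusU_iff_mem_centralizer_of_isUnit_sub hdt hregd (Ψ g).1, Subgroup.mem_centralizer_singleton_iff,
      Subgroup.mem_centralizer_singleton_iff]
    change (Ψ g).1 * (Ψ (γ₂, γ₁)).1 = (Ψ (γ₂, γ₁)).1 * (Ψ g).1 ↔ g.1 * γ₂ = γ₂ * g.1
    rw [← Prod.fst_mul, ← Prod.fst_mul, ← map_mul, ← map_mul]
    constructor
    · intro h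
      have h' := congrArg Prod.fst (Ψ.injective (Prod.ext h (by rw [hΨ2, hΨ2, Prod.snd_mul, Prod.snd_mul, hU])))
      simpa using h'
    · intro h
      have h' : g * (γ₂, γ₁) = (γ₂, γ₁) * g := Prod.ext (by simpa using h) (hU _ _)
      rw [h']
  -- Step 3: Haar measures on `G`, its subgroups (TRANSPORTED from `κ₂ ⊗ κ₁`, `μ_{N₂}`), and the Iwasawa form of `Ψ_*νH ∕ Ψ_*t_Z`
  obtain ⟨ν, hν⟩ : ∃ ν : Measure (↥(unitaryGroupOfForm (conjLocal L (IsCMField.complexConj L) v) (cmLocalForm L 2 v)) × (cmDatum L 1 (Matrix.of fun i j : Fin 1 => if i.val + j.val + 1 = 1 then (1 : L) else 0)).Local v), ν = Measure.map Ψ νH := ⟨_, rfl⟩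
  haveI : ν.IsHaarMeasure := by rw [hν]; exact MulEquiv.isHaarMeasure_map νH Ψ hΨ hΨs
  haveI : ν.IsMulRightInvariant := by rw [hν]; exact isMulRightInvariant_map_mulEquiv_of_isMulRightInvariant Ψ hΨ.measurable νH
  haveI : ν.IsInvInvariant := isInvInvariant_of_isMulRightInvariant ν
  let eH := subgroupCongrHomeomorph Ψ (Subgroup.centralizer ({(γ₂, γ₁)} : Set ((cmDatum L 2 (Matrix.of fun i j : Fin 2 => if i.val + j.val + 1 = 2 then (1 : L) else 0)).Local v × (cmDatum L 1 (Matrix.of fun i j : Fin 1 => if i.val + j.val + 1 = 1 then (1 : L) else 0)).Local v))) ((torusU (conjLocal L (IsCMField.complexConj L) v) (cmLocalForm L 2 v)).prod (⊤ : Subgroup ((cmDatum L 1 (Matrix.of fun i j : Fin 1 => if i.val + j.val + 1 = 1 then (1 : L) else 0)).Local v))) hZT hΨ hΨs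
  let eZ : ↥(Subgroup.centralizer ({(γ₂, γ₁)} : Set ((cmDatum L 2 (Matrix.of fun i j : Fin 2 => if i.val + j.val + 1 = 2 then (1 : L) else 0)).Local v × (cmDatum L 1 (Matrix.of fun i j : Fin 1 => if i.val + j.val + 1 = 1 then (1 : L) else 0)).Local v))) ≃ₜ* ↥((torusU (conjLocal L (IsCMField.complexConj L) v) (cmLocalForm L 2 v)).prod (⊤ : Subgroup ((cmDatum L 1 (Matrix.of fun i j : Fin 1 => if i.val + j.val + 1 = 1 then (1 : L) else 0)).Local v))) :=
    { toMulEquiv :=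
        { toEquiv := eH.toEquiv
          map_mul' := fun a b => Subtype.ext (map_mul Ψ (a : ((cmDatum L 2 (Matrix.of fun i j : Fin 2 => if i.val + j.val + 1 = 2 then (1 : L) else 0)).Local v × (cmDatum L 1 (Matrix.of fun i j : Fin 1 => if i.val + j.val + 1 = 1 then (1 : L) else 0)).Local v)) (b : ((cmDatum L 2 (Matrix.of fun i j : Fin 2 => if i.val + j.val + 1 = 2 then (1 : L) else 0)).Local v × (cmDatum L 1 (Matrix.of fun i j : Fin 1 => if i.val + j.val + 1 = 1 then (1 : L) else 0)).Local v))) }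
      continuous_toFun := eH.continuous
      continuous_invFun := eH.symm.continuous }
  have heZ : (eZ : _ → ↥((torusU (conjLocal L (IsCMField.complexConj L) v) (cmLocalForm L 2 v)).prod (⊤ : Subgroup ((cmDatum L 1 (Matrix.of fun i j : Fin 1 => if i.val + j.val + 1 = 1 then (1 : L) else 0)).Local v)))) = eH := rfl
  obtain ⟨tT, htT⟩ : ∃ tT : Measure ↥((torusU (conjLocal L (IsCMField.complexConj L) v) (cmLocalForm L 2 v)).prod (⊤ : Subgroup ((cmDatum L 1 (Matrix.of fun i j : Fin 1 => if i.val + j.val + 1 = 1 then (1 : L) else 0)).Local v))), tT = Measure.map eH tZ := ⟨_, rfl⟩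
  haveI : tT.IsHaarMeasure := by rw [htT, ← heZ]; exact MulEquiv.isHaarMeasure_map tZ eZ.toMulEquiv eZ.continuous eZ.symm.continuous
  haveI : tT.IsInvInvariant := by rw [htT, ← heZ]; exact isInvInvariant_map_mulEquiv eZ.toMulEquiv eZ.continuous.measurable tZ
  -- the transports `eK : K₂ × K₁ ≃ K₂.prod K₁`, `eN : N₂ ≃ N₂ × 1`
  let eK : ↥K₂ × ↥(cmLocalIntegralLevel L 1 (Matrix.of fun i j : Fin 1 => if i.val + j.val + 1 = 1 then (1 : L) else 0) v) ≃ₜ* ↥(((K₂.prod (cmLocalIntegralLevel L 1 (Matrix.of fun i j : Fin 1 => if i.val + j.val + 1 = 1 then (1 : L) else 0) v))) : Subgroup (↥(unitaryGroupOfForm (conjLocal L (IsCMField.complexConj L) v) (cmLocalForm L 2 v)) × (cmDatum L 1 (Matrix.of fun i j : Fin 1 => if i.val + j.val + 1 = 1 then (1 : L) else 0)).Local v)) :=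
    { toFun := fun q => ⟨((q.1 : ↥(unitaryGroupOfForm (conjLocal L (IsCMField.complexConj L) v) (cmLocalForm L 2 v))), (q.2 : (cmDatum L 1 (Matrix.of fun i j : Fin 1 => if i.val + j.val + 1 = 1 then (1 : L) else 0)).Local v)), Subgroup.mem_prod.2 ⟨q.1.2, q.2.2⟩⟩
      invFun := fun p => (⟨(p : ↥(unitaryGroupOfForm (conjLocal L (IsCMField.complexConj L) v) (cmLocalForm L 2 v)) × (cmDatum L 1 (Matrix.of fun i j : Fin 1 => if i.val + j.val + 1 = 1 then (1 : L) else 0)).Local v).1, (Subgroup.mem_prod.1 p.2).1⟩, ⟨(p : ↥(unitaryGroupOfForm (conjLocal L (IsCMField.complexConj L) v) (cmLocalForm L 2 v)) × (cmDatum L 1 (Matrix.of fun i j : Fin 1 => if i.val + j.val + 1 = 1 then (1 : L) else 0)).Local v).2, (Subgroup.mem_prod.1 p.2).2⟩)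
      left_inv := fun _ => rfl
      right_inv := fun _ => rfl
      map_mul' := fun _ _ => rfl
      continuous_toFun := ((continuous_subtype_val.comp continuous_fst).prodMk (continuous_subtype_val.comp continuous_snd)).subtype_mk _
      continuous_invFun := ((continuous_fst.comp continuous_subtype_val).subtype_mk _).prodMk ((continuous_snd.comp continuous_subtype_val).subtype_mk _) }
  have heK : ∀ q, ((eK q : ↥(((K₂.prod (cmLocalIntegralLevel L 1 (Matrix.of fun i j : Fin 1 => if i.val + j.val + 1 = 1 then (1 : L) else 0) v))) : Subgroup (↥(unitaryGroupOfForm (conjLocal L (IsCMField.complexConj L) v) (cmLocalForm L 2 v)) × (cmDatum L 1 (Matrix.of fun i j : Fin 1 => if i.val + j.val + 1 = 1 then (1 : L) else 0)).Local v))) : ↥(unitaryGroupOfForm (conjLocal L (IsCMField.complexConj L) v) (cmLocalForm L 2 v)) × (cmDatum L 1 (Matrix.of fun i j : Fin 1 => if i.val + j.val + 1 = 1 then (1 : L) else 0)).Local v) = ((q.1 : ↥(unitaryGroupOfForm (conjLocal L (IsCMField.complexConj L) v) (cmLocalForm L 2 v))), (q.2 : (cmDatum L 1 (Matrix.of fun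 i j : Fin 1 => if i.val + j.val + 1 = 1 then (1 : L) else 0)).Local v)) := fun _ => rfl
  let eN : ↥(cmBorelTriple L 2 v).N ≃ₜ* ↥((unipotentU (conjLocal L (IsCMField.complexConj L) v) (cmLocalForm L 2 v)).prod (⊥ : Subgroup ((cmDatum L 1 (Matrix.of fun i j : Fin 1 => if i.val + j.val + 1 = 1 then (1 : L) else 0)).Local v))) :=
    { toFun := fun n => ⟨((n : ↥(unitaryGroupOfForm (conjLocal L (IsCMField.complexConj L) v) (cmLocalForm L 2 v))), 1), Subgroup.mem_prod.2 ⟨n.2, Subgroup.one_mem _⟩⟩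
      invFun := fun m => ⟨(m : ↥(unitaryGroupOfForm (conjLocal L (IsCMField.complexConj L) v) (cmLocalForm L 2 v)) × (cmDatum L 1 (Matrix.of fun i j : Fin 1 => if i.val + j.val + 1 = 1 then (1 : L) else 0)).Local v).1, (Subgroup.mem_prod.1 m.2).1⟩
      left_inv := fun _ => rfl
      right_inv := fun m => Subtype.ext (Prod.ext rfl (snd_eq_one_of_mem_prodBot m.2).symm)
      map_mul' := fun _ _ => Subtype.ext (Prod.ext rfl (mul_one _).symm)
      continuous_toFun := ((continuous_subtype_val.prodMk continuous_const)).subtype_mk _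
      continuous_invFun := (continuous_fst.comp continuous_subtype_val).subtype_mk _ }
  have heN : ∀ n, ((eN n : ↥((unipotentU (conjLocal L (IsCMField.complexConj L) v) (cmLocalForm L 2 v)).prod (⊥ : Subgroup ((cmDatum L 1 (Matrix.of fun i j : Fin 1 => if i.val + j.val + 1 = 1 then (1 : L) else 0)).Local v)))) : ↥(unitaryGroupOfForm (conjLocal L (IsCMField.complexConj L) v) (cmLocalForm L 2 v)) × (cmDatum L 1 (Matrix.of fun i j : Fin 1 => if i.val + j.val + 1 = 1 then (1 : L) else 0)).Local v) = ((n : ↥(unitaryGroupOfForm (conjLocal L (IsCMField.complexConj L) v) (cmLocalForm L 2 v))), 1) := fun _ => rfl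
  obtain ⟨κ₁, hκ₁⟩ : ∃ κ₁ : Measure ↥(cmLocalIntegralLevel L 1 (Matrix.of fun i j : Fin 1 => if i.val + j.val + 1 = 1 then (1 : L) else 0) v), κ₁.IsHaarMeasure := ⟨Measure.haar, inferInstance⟩
  haveI := hκ₁
  haveI : IsFiniteMeasure κ₁ := CompactSpace.isFiniteMeasure
  haveI : IsFiniteMeasure κ₂ := CompactSpace.isFiniteMeasure
  haveI : BorelSpace (↥K₂ × ↥(cmLocalIntegralLevel L 1 (Matrix.of fun i j : Fin 1 => if i.val + j.val + 1 = 1 then (1 : L) else 0) v)) := Prod.borelSpace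
  set κ : Measure ↥(((K₂.prod (cmLocalIntegralLevel L 1 (Matrix.of fun i j : Fin 1 => if i.val + j.val + 1 = 1 then (1 : L) else 0) v))) : Subgroup (↥(unitaryGroupOfForm (conjLocal L (IsCMField.complexConj L) v) (cmLocalForm L 2 v)) × (cmDatum L 1 (Matrix.of fun i j : Fin 1 => if i.val + j.val + 1 = 1 then (1 : L) else 0)).Local v)) := (κ₂.prod κ₁).map eK with hκdef
  haveI : κ.IsHaarMeasure := ContinuousMulEquiv.isHaarMeasure_map (κ₂.prod κ₁) eK
  set μN : Measure ↥((unipotentU (conjLocal L (IsCMField.complexConj L) v) (cmLocalForm L 2 v)).prod (⊥ : Subgroup ((cmDatum L 1 (Matrix.of fun i j : Fin 1 => if i.val + j.val + 1 = 1 then (1 : L) else 0)).Local v))) := μN₂.map eN with hμNdef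
  haveI : μN.IsHaarMeasure := ContinuousMulEquiv.isHaarMeasure_map μN₂ eN
  haveI : μN.IsInvInvariant := Literature.MeasureTheory.Group.isInvInvariant_of_comm _ hNc (fun x hx y hy =>
    congrArg Subtype.val (mul_comm_prodBot (fun a b => mul_comm_two (conjLocal L (IsCMField.complexConj L) v) (J := cmLocalForm L 2 v) a b) ⟨x, hx⟩ ⟨y, hy⟩)) μN
  haveI : SMulInvariantMeasure (↥(unitaryGroupOfForm (conjLocal L (IsCMField.complexConj L) v) (cmLocalForm L 2 v)) × (cmDatum L 1 (Matrix.of fun i j : Fin 1 => if i.val + j.val + 1 = 1 then (1 : L) else 0)).Local v) ((↥(unitaryGroupOfForm (conjLocal L (IsCMField.complexConj L) v) (cmLocalForm L 2 v)) × (cmDatum L 1 (Matrix.of fun i j : Fin 1 => if i.val + j.val + 1 = 1 then (1 : L) else 0)).Local v) ⧸ ((torusU (conjLocal L (IsCMField.complexConj L) v) (cmLocalForm L 2 v)).prod (⊤ : Subgroup ((cmDatum L 1 (Matrix.of fun i j : Fin 1 => if i.val + j.val + 1 = 1 then (1 : L) else 0)).Local v)))) (quotientMeasure ((torusU (conjLocal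 L (IsCMField.complexConj L) v) (cmLocalForm L 2 v)).prod (⊤ : Subgroup ((cmDatum L 1 (Matrix.of fun i j : Fin 1 => if i.val + j.val + 1 = 1 then (1 : L) else 0)).Local v))) tT hT ν) := smulInvariantMeasure_quotientMeasure _ tT hT ν
  have hμ0 : quotientMeasure ((torusU (conjLocal L (IsCMField.complexConj L) v) (cmLocalForm L 2 v)).prod (⊤ : Subgroup ((cmDatum L 1 (Matrix.of fun i j : Fin 1 => if i.val + j.val + 1 = 1 then (1 : L) else 0)).Local v))) tT hT ν ≠ 0 := quotientMeasure_ne_zero _ tT hT ν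
  have hTN := conj_mem_prodBot hZ (fun a ha n hn => conj_mem_unipotentU_cmLocal_two L v ha hn)
  have hKP : ∀ ⦃m n : ↥(unitaryGroupOfForm (conjLocal L (IsCMField.complexConj L) v) (cmLocalForm L 2 v)) × (cmDatum L 1 (Matrix.of fun i j : Fin 1 => if i.val + j.val + 1 = 1 then (1 : L) else 0)).Local v⦄, m ∈ ((torusU (conjLocal L (IsCMField.complexConj L) v) (cmLocalForm L 2 v)).prod (⊤ : Subgroup ((cmDatum L 1 (Matrix.of fun i j : Fin 1 => if i.val + j.val + 1 = 1 then (1 : L) else 0)).Local v))) → n ∈ ((unipotentU (conjLocal L (IsCMField.complexConj L) v) (cmLocalForm L 2 v)).prod (⊥ : Subgroup ((cmDatum L 1 (Matrix.of fun i j : Fin 1 => if i.val + j.val + 1 = 1 then (1 : L) else 0)).Local v))) → m * n ∈ (K₂.prod (cmLocalIntegralLevel L 1 (Matrix.of fun i j : Fin 1 => if i.val + j.val + 1 = 1 then (1 : L) else 0) v)) → m ∈ (K₂.prod (cmLocalIntegralLevel L 1 (Matrix.of fun i j : Fin 1 => if i.val + j.val + 1 = 1 then (1 : L) else 0) v)) :=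 by
    refine mem_prod_of_mul_mem hZ (fun m u' hm hu' h => ?_) hK₁
    rw [hK2] at h ⊢
    exact mem_cmLocalIntegralLevel_of_torus_mul_unipotent L 2 v hm hu' h
  have hKB : ∀ g : ↥(unitaryGroupOfForm (conjLocal L (IsCMField.complexConj L) v) (cmLocalForm L 2 v)) × (cmDatum L 1 (Matrix.of fun i j : Fin 1 => if i.val + j.val + 1 = 1 then (1 : L) else 0)).Local v, ∃ k ∈ (K₂.prod (cmLocalIntegralLevel L 1 (Matrix.of fun i j : Fin 1 => if i.val + j.val + 1 = 1 then (1 : L) else 0) v)), ∃ b ∈ ((borelU (conjLocal L (IsCMField.complexConj L) v) (cmLocalForm L 2 v)).prod (⊤ : Subgroup ((cmDatum L 1 (Matrix.of fun i j : Fin 1 => if i.val + j.val + 1 = 1 then (1 : L) else 0)).Local v))), g = k * b := by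
    refine exists_mem_prod_mul fun g => ?_
    obtain ⟨k, hk, b, hb'⟩ := exists_mem_cmLocalIntegralLevel_mul_borel L 2 v g
    exact ⟨k, by rw [hK2]; exact hk, b.1, b.2, hb'⟩
  obtain ⟨e₂, he₂⟩ := exists_borelHomeomorph_two (conjLocal L (IsCMField.complexConj L) v) (cmLocalForm_eq_over L 2 v)
  obtain ⟨e, he⟩ := exists_homeomorph_prod_anMap (U := (cmDatum L 1 (Matrix.of fun i j : Fin 1 => if i.val + j.val + 1 = 1 then (1 : L) else 0)).Local v) (torusU_le_borelU _ _) (unipotentU_le_borelU _ _) hZ e₂ he₂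
  obtain ⟨C, -, hμC⟩ := exists_measure_quotient_eq_smul_map hKco.1 hT hB (le_prod_top hZ (torusU_le_borelU _ _))
    (prodBot_le_prod_top (unipotentU_le_borelU _ _)) hTN e he hKB ν κ tT μN (quotientMeasure ((torusU (conjLocal L (IsCMField.complexConj L) v) (cmLocalForm L 2 v)).prod (⊤ : Subgroup ((cmDatum L 1 (Matrix.of fun i j : Fin 1 => if i.val + j.val + 1 = 1 then (1 : L) else 0)).Local v))) tT hT ν) hμ0
  -- Step 4: the normalisation `t_T(T ∩ K) = 1` and the value `ν(K) = νH(K_H)`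
  have hK' : ∀ g : ((cmDatum L 2 (Matrix.of fun i j : Fin 2 => if i.val + j.val + 1 = 2 then (1 : L) else 0)).Local v × (cmDatum L 1 (Matrix.of fun i j : Fin 1 => if i.val + j.val + 1 = 1 then (1 : L) else 0)).Local v), g ∈ ((((cmLocalIntegralLevel L 2 (Matrix.of fun i j : Fin 2 => if i.val + j.val + 1 = 2 then (1 : L) else 0) v).prod (cmLocalIntegralLevel L 1 (Matrix.of fun i j : Fin 1 => if i.val + j.val + 1 = 1 then (1 : L) else 0) v)) : Subgroup ((cmDatum L 2 (Matrix.of fun i j : Fin 2 => if i.val + j.val + 1 = 2 then (1 : L) else 0)).Local v × (cmDatum L 1 (Matrix.of fun i j : Fin 1 => if i.val + j.val + 1 = 1 then (1 : L) else 0)).Local v))) ↔ Ψ g ∈ (K₂.prod (cmLocalIntegralLevel L 1 (Matrix.of fun i j : Fin 1 => if i.val + j.val + 1 = 1 then (1 : L) else 0) v)) := fun g => by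
    rw [Subgroup.mem_prod, Subgroup.mem_prod, hK2]; exact Iff.rfl
  have hΨm : Measurable (Ψ : ((cmDatum L 2 (Matrix.of fun i j : Fin 2 => if i.val + j.val + 1 = 2 then (1 : L) else 0)).Local v × (cmDatum L 1 (Matrix.of fun i j : Fin 1 => if i.val + j.val + 1 = 1 then (1 : L) else 0)).Local v) → ↥(unitaryGroupOfForm (conjLocal L (IsCMField.complexConj L) v) (cmLocalForm L 2 v)) × (cmDatum L 1 (Matrix.of fun i j : Fin 1 => if i.val + j.val + 1 = 1 then (1 : L) else 0)).Local v) := hΨ.measurable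
  have hνK : ν ((((K₂.prod (cmLocalIntegralLevel L 1 (Matrix.of fun i j : Fin 1 => if i.val + j.val + 1 = 1 then (1 : L) else 0) v))) : Subgroup (↥(unitaryGroupOfForm (conjLocal L (IsCMField.complexConj L) v) (cmLocalForm L 2 v)) × (cmDatum L 1 (Matrix.of fun i j : Fin 1 => if i.val + j.val + 1 = 1 then (1 : L) else 0)).Local v)) : Set (↥(unitaryGroupOfForm (conjLocal L (IsCMField.complexConj L) v) (cmLocalForm L 2 v)) × (cmDatum L 1 (Matrix.of fun i j : Fin 1 => if i.val + j.val + 1 = 1 then (1 : L) else 0)).Local v)) = νH ((((cmLocalIntegralLevel L 2 (Matrix.of fun i j : Fin 2 => if i.val + j.val + 1 = 2 then (1 : L) else 0) v).prod (cmLocalIntegralLevel L 1 (Matrix.of fun i j : Fin 1 => if i.val + j.val + 1 = 1 then (1 : L) else 0) v)) : Subgroup ((cmDatum L 2 (Matrix.of fun i j : Fin 2 => if i.val + j.val + 1 = 2 then (1 : L) else 0)).Local v × (cmDatum L 1 (Matrix.of fun i j : Fin 1 => if i.val + j.val + 1 = 1 then (1 : L) else 0)).Local v)) : Set ((cmDatum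 L 2 (Matrix.of fun i j : Fin 2 => if i.val + j.val + 1 = 2 then (1 : L) else 0)).Local v × (cmDatum L 1 (Matrix.of fun i j : Fin 1 => if i.val + j.val + 1 = 1 then (1 : L) else 0)).Local v)) := by
    rw [hν, Measure.map_apply hΨm hKco.2.measurableSet]
    congr 1
    ext g; exact (hK' g).symm
  have htK1 : tT (Subtype.val ⁻¹' ((((K₂.prod (cmLocalIntegralLevel L 1 (Matrix.of fun i j : Fin 1 => if i.val + j.val + 1 = 1 then (1 : L) else 0) v))) : Subgroup (↥(unitaryGroupOfForm (conjLocal L (IsCMField.complexConj L) v) (cmLocalForm L 2 v)) × (cmDatum L 1 (Matrix.of fun i j : Fin 1 => if i.val + j.val + 1 = 1 then (1 : L) else 0)).Local v)) : Set (↥(unitaryGroupOfForm (conjLocal L (IsCMField.complexConj L) v) (cmLocalForm L 2 v)) × (cmDatum L 1 (Matrix.of fun i j : Fin 1 => if i.val + j.val + 1 = 1 then (1 : L) else 0)).Local v))) = 1 := by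
    rw [htT, Measure.map_apply eH.continuous.measurable (hKco.2.preimage continuous_subtype_val).measurableSet]
    have hpre : (eH : _ → ↥((torusU (conjLocal L (IsCMField.complexConj L) v) (cmLocalForm L 2 v)).prod (⊤ : Subgroup ((cmDatum L 1 (Matrix.of fun i j : Fin 1 => if i.val + j.val + 1 = 1 then (1 : L) else 0)).Local v)))) ⁻¹' (Subtype.val ⁻¹' ((((K₂.prod (cmLocalIntegralLevel L 1 (Matrix.of fun i j : Fin 1 => if i.val + j.val + 1 = 1 then (1 : L) else 0) v))) : Subgroup (↥(unitaryGroupOfForm (conjLocal L (IsCMField.complexConj L) v) (cmLocalForm L 2 v)) × (cmDatum L 1 (Matrix.of fun i j : Fin 1 => if i.val + j.val + 1 = 1 then (1 : L) else 0)).Local v)) : Set (↥(unitaryGroupOfForm (conjLocal L (IsCMField.complexConj L) v) (cmLocalForm L 2 v)) × (cmDatum L 1 (Matrix.of fun i j : Fin 1 => if i.val + j.val + 1 = 1 then (1 : L) else 0)).Local v))) =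
        Subtype.val ⁻¹' ((((cmLocalIntegralLevel L 2 (Matrix.of fun i j : Fin 2 => if i.val + j.val + 1 = 2 then (1 : L) else 0) v).prod (cmLocalIntegralLevel L 1 (Matrix.of fun i j : Fin 1 => if i.val + j.val + 1 = 1 then (1 : L) else 0) v)) : Subgroup ((cmDatum L 2 (Matrix.of fun i j : Fin 2 => if i.val + j.val + 1 = 2 then (1 : L) else 0)).Local v × (cmDatum L 1 (Matrix.of fun i j : Fin 1 => if i.val + j.val + 1 = 1 then (1 : L) else 0)).Local v)) : Set ((cmDatum L 2 (Matrix.of fun i j : Fin 2 => if i.val + j.val + 1 = 2 then (1 : L) else 0)).Local v × (cmDatum L 1 (Matrix.of fun i j : Fin 1 => if i.val + j.val + 1 = 1 then (1 : L) else 0)).Local v)) := by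
      ext z
      simp only [Set.mem_preimage]
      exact (hK' (z : ((cmDatum L 2 (Matrix.of fun i j : Fin 2 => if i.val + j.val + 1 = 2 then (1 : L) else 0)).Local v × (cmDatum L 1 (Matrix.of fun i j : Fin 1 => if i.val + j.val + 1 = 1 then (1 : L) else 0)).Local v))).symm
    rw [hpre]
    exact measure_preimage_eq_one_of_compactCore_subset _ tZ htZ1 _ hKHco.1 hcore
  -- Step 5: the twist `J_H` on `N₂ × 1` and the transported descent (★ S0 FILE 1 §3), then §1
  haveI : BorelSpace ↥(unipotentU (conjLocal L (IsCMField.complexConj L) v) (cmLocalForm L 2 v)) := Subtype.borelSpace _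
  have htT' : Ψ (γ₂, γ₁) ∈ ((torusU (conjLocal L (IsCMField.complexConj L) v) (cmLocalForm L 2 v)).prod (⊤ : Subgroup ((cmDatum L 1 (Matrix.of fun i j : Fin 1 => if i.val + j.val + 1 = 1 then (1 : L) else 0)).Local v))) := (hZ _).2 ht₂
  have ht' : ∀ a ∈ ((torusU (conjLocal L (IsCMField.complexConj L) v) (cmLocalForm L 2 v)).prod (⊤ : Subgroup ((cmDatum L 1 (Matrix.of fun i j : Fin 1 => if i.val + j.val + 1 = 1 then (1 : L) else 0)).Local v))), a * Ψ (γ₂, γ₁) = Ψ (γ₂, γ₁) * a := fun a ha =>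
    mul_comm_of_mem hZ (fun x hx y hy => mul_comm_of_mem_torusU_cmLocal_two L v hx hy) hU a ha _ htT'
  haveI : SecondCountableTopology (LocalRing L v) := secondCountableTopology_localRing (E := L) v
  have hJac : ∀ Φ : ↥(unitaryGroupOfForm (conjLocal L (IsCMField.complexConj L) v) (cmLocalForm L 2 v)) × (cmDatum L 1 (Matrix.of fun i j : Fin 1 => if i.val + j.val + 1 = 1 then (1 : L) else 0)).Local v → ℝ≥0∞, Measurable Φ →
      ∫⁻ n, Φ ((n : ↥(unitaryGroupOfForm (conjLocal L (IsCMField.complexConj L) v) (cmLocalForm L 2 v)) × (cmDatum L 1 (Matrix.of fun i j : Fin 1 => if i.val + j.val + 1 = 1 then (1 : L) else 0)).Local v) * Ψ (γ₂, γ₁) * (n : ↥(unitaryGroupOfForm (conjLocal L (IsCMField.complexConj L) v) (cmLocalForm L 2 v)) × (cmDatum L 1 (Matrix.of fun i j : Fin 1 => if i.val + j.val + 1 = 1 then (1 : L) else 0)).Local v)⁻¹) ∂μN = ((letI : MeasurableSpace (LocalRing L v) := borel _; haveI : BorelSpace (LocalRing L v) := ⟨rfl⟩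
          haveI : SecondCountableTopology (LocalRing L v) := secondCountableTopology_localRing (E := L) v
          ((skewModulus (conjLocal L (IsCMField.complexConj L) v) (continuous_conjLocal L (IsCMField.complexConj L) v) hb.unit
            (map_unit_torusScalar_sub_one_two (conjLocal L (IsCMField.complexConj L) v) (cmLocalForm_eq_over L 2 v)
              (⟨(t : ↥(unitaryGroupOfForm (conjLocal L (IsCMField.complexConj L) v) (cmLocalForm L 2 v))), t.2⟩ : ↥(torusU (conjLocal L (IsCMField.complexConj L) v) (cmLocalForm L 2 v))) hd hb))⁻¹ : ℝ≥0)) : ℝ≥0∞) * ∫⁻ n, Φ (Ψ (γ₂, γ₁) * (n : ↥(unitaryGroupOfForm (conjLocal L (IsCMField.complexConj L) v) (cmLocalForm L 2 v)) × (cmDatum L 1 (Matrix.of fun i j : Fin 1 => if i.val + j.val + 1 = 1 then (1 : L) else 0)).Local v)) ∂μN := by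
    intro Φ hΦ
    have hΨγ : Ψ (γ₂, γ₁) = (t₂, γ₁) := rfl
    rw [hΨγ]
    letI : MeasurableSpace (LocalRing L v) := borel _
    haveI : BorelSpace (LocalRing L v) := ⟨rfl⟩
    exact lintegral_conj_prodBot_eq_mul t₂ γ₁ (fun μ₂ _ Φ₂ hΦ₂ =>
      lintegral_conj_eq_mul_lintegral_mul_two (conjLocal L (IsCMField.complexConj L) v) (continuous_conjLocal L (IsCMField.complexConj L) v)
        (cmLocalForm_eq_over L 2 v) μ₂ ht₂ hdt hb Φ₂ hΦ₂) μN Φ hΦ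
  have key := orbitalIntegral_centralizer_quotientMeasure_eq_smul_integral_of_mulEquiv (G := ↥(unitaryGroupOfForm (conjLocal L (IsCMField.complexConj L) v) (cmLocalForm L 2 v)) × (cmDatum L 1 (Matrix.of fun i j : Fin 1 => if i.val + j.val + 1 = 1 then (1 : L) else 0)).Local v) hKco.2 hKco.1 hT hTN hKP ν tT κ μN Ψ hΨ hΨs
    (γ₂, γ₁) hZT νH hν tZ htT hμC htK1 ht' hJac hφ
  rw [key, hνK]
  -- §1: collapse the `K₁`-average
  have hφΨ : Measurable (φ ∘ Ψ.symm) := hφ.comp hΨs.measurable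
  have hcollapse := integral_prod_prodBot_conj_eq_smul_integral_prod (A := ↥(unitaryGroupOfForm (conjLocal L (IsCMField.complexConj L) v) (cmLocalForm L 2 v))) (U := (cmDatum L 1 (Matrix.of fun i j : Fin 1 => if i.val + j.val + 1 = 1 then (1 : L) else 0)).Local v) hU eK heK eN heN κ₂ κ₁ μN₂ (Ψ (γ₂, γ₁)) hφΨ
  have hκμ : (κ.prod μN) = (((κ₂.prod κ₁).map eK).prod (μN₂.map eN)) := rfl
  rw [hκμ]
  have hint_eq : (fun p : ↥(((K₂.prod (cmLocalIntegralLevel L 1 (Matrix.of fun i j : Fin 1 => if i.val + j.val + 1 = 1 then (1 : L) else 0) v))) : Subgroup (↥(unitaryGroupOfForm (conjLocal L (IsCMField.complexConj L) v) (cmLocalForm L 2 v)) × (cmDatum L 1 (Matrix.of fun i j : Fin 1 => if i.val + j.val + 1 = 1 then (1 : L) else 0)).Local v)) × ↥((unipotentU (conjLocal L (IsCMField.complexConj L) v) (cmLocalForm L 2 v)).prod (⊥ : Subgroup ((cmDatum L 1 (Matrix.of fun i j : Fin 1 => if i.val + j.val + 1 = 1 then (1 : L) else 0)).Local v))) =>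
        φ (Ψ.symm ((p.1 : ↥(unitaryGroupOfForm (conjLocal L (IsCMField.complexConj L) v) (cmLocalForm L 2 v)) × (cmDatum L 1 (Matrix.of fun i j : Fin 1 => if i.val + j.val + 1 = 1 then (1 : L) else 0)).Local v) * (Ψ (γ₂, γ₁) * (p.2 : ↥(unitaryGroupOfForm (conjLocal L (IsCMField.complexConj L) v) (cmLocalForm L 2 v)) × (cmDatum L 1 (Matrix.of fun i j : Fin 1 => if i.val + j.val + 1 = 1 then (1 : L) else 0)).Local v)) * (p.1 : ↥(unitaryGroupOfForm (conjLocal L (IsCMField.complexConj L) v) (cmLocalForm L 2 v)) × (cmDatum L 1 (Matrix.of fun i j : Fin 1 => if i.val + j.val + 1 = 1 then (1 : L) else 0)).Local v)⁻¹))) =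
      fun p => (φ ∘ Ψ.symm) ((p.1 : ↥(unitaryGroupOfForm (conjLocal L (IsCMField.complexConj L) v) (cmLocalForm L 2 v)) × (cmDatum L 1 (Matrix.of fun i j : Fin 1 => if i.val + j.val + 1 = 1 then (1 : L) else 0)).Local v) * (Ψ (γ₂, γ₁) * (p.2 : ↥(unitaryGroupOfForm (conjLocal L (IsCMField.complexConj L) v) (cmLocalForm L 2 v)) × (cmDatum L 1 (Matrix.of fun i j : Fin 1 => if i.val + j.val + 1 = 1 then (1 : L) else 0)).Local v)) * (p.1 : ↥(unitaryGroupOfForm (conjLocal L (IsCMField.complexConj L) v) (cmLocalForm L 2 v)) × (cmDatum L 1 (Matrix.of fun i j : Fin 1 => if i.val + j.val + 1 = 1 then (1 : L) else 0)).Local v)⁻¹) := rfl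
  rw [hint_eq, hcollapse]
  -- the constants: `κ(univ) = κ₂(univ) κ₁(univ)`, `μN(N ∩ K) = μ_{N₂}(N₂ ∩ K₂)`, and `κ₁(univ)` cancels
  have hκu : κ Set.univ = κ₂ Set.univ * κ₁ Set.univ := by
    have hmeK : Measurable (eK : ↥K₂ × ↥(cmLocalIntegralLevel L 1 (Matrix.of fun i j : Fin 1 => if i.val + j.val + 1 = 1 then (1 : L) else 0) v) → ↥((K₂.prod (cmLocalIntegralLevel L 1 (Matrix.of fun i j : Fin 1 => if i.val + j.val + 1 = 1 then (1 : L) else 0) v)) : Subgroup (↥(unitaryGroupOfForm (conjLocal L (IsCMField.complexConj L) v) (cmLocalForm L 2 v)) × (cmDatum L 1 (Matrix.of fun i j : Fin 1 => if i.val + j.val + 1 = 1 then (1 : L) else 0)).Local v))) :=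
      eK.continuous.measurable
    rw [hκdef, Measure.map_apply hmeK MeasurableSet.univ, Set.preimage_univ, ← Set.univ_prod_univ, Measure.prod_prod]
  have hμNK : μN {n : ↥((unipotentU (conjLocal L (IsCMField.complexConj L) v) (cmLocalForm L 2 v)).prod (⊥ : Subgroup ((cmDatum L 1 (Matrix.of fun i j : Fin 1 => if i.val + j.val + 1 = 1 then (1 : L) else 0)).Local v))) | (n : ↥(unitaryGroupOfForm (conjLocal L (IsCMField.complexConj L) v) (cmLocalForm L 2 v)) × (cmDatum L 1 (Matrix.of fun i j : Fin 1 => if i.val + j.val + 1 = 1 then (1 : L) else 0)).Local v) ∈ (K₂.prod (cmLocalIntegralLevel L 1 (Matrix.of fun i j : Fin 1 => if i.val + j.val + 1 = 1 then (1 : L) else 0) v))} = μN₂ {n | (n : ↥(unitaryGroupOfForm (conjLocal L (IsCMField.complexConj L) v) (cmLocalForm L 2 v))) ∈ K₂} := by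
    have hms : MeasurableSet {n : ↥((unipotentU (conjLocal L (IsCMField.complexConj L) v) (cmLocalForm L 2 v)).prod (⊥ : Subgroup ((cmDatum L 1 (Matrix.of fun i j : Fin 1 => if i.val + j.val + 1 = 1 then (1 : L) else 0)).Local v))) | (n : ↥(unitaryGroupOfForm (conjLocal L (IsCMField.complexConj L) v) (cmLocalForm L 2 v)) × (cmDatum L 1 (Matrix.of fun i j : Fin 1 => if i.val + j.val + 1 = 1 then (1 : L) else 0)).Local v) ∈ (K₂.prod (cmLocalIntegralLevel L 1 (Matrix.of fun i j : Fin 1 => if i.val + j.val + 1 = 1 then (1 : L) else 0) v))} :=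
      measurable_subtype_coe hKco.2.measurableSet
    have hmeN : Measurable (eN : ↥(cmBorelTriple L 2 v).N → ↥((unipotentU (conjLocal L (IsCMField.complexConj L) v) (cmLocalForm L 2 v)).prod (⊥ : Subgroup ((cmDatum L 1 (Matrix.of fun i j : Fin 1 => if i.val + j.val + 1 = 1 then (1 : L) else 0)).Local v)))) :=
      eN.continuous.measurable
    rw [hμNdef, Measure.map_apply hmeN hms]
    congr 1
    ext n
    simp only [Set.mem_preimage, Set.mem_setOf_eq, heN, Subgroup.mem_prod]
    exact ⟨fun h => h.1, fun h => ⟨h, Subgroup.one_mem _⟩⟩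
  have hκ₁0 : κ₁ Set.univ ≠ 0 := isOpen_univ.measure_ne_zero κ₁ Set.univ_nonempty
  have hκ₁top : κ₁ Set.univ ≠ ⊤ := measure_ne_top _ _
  rw [hκu, hμNK, smul_smul]
  have hΨs1 : ∀ q : ↥K₂ × ↥(cmBorelTriple L 2 v).N,
      (φ ∘ Ψ.symm) (((q.1 : ↥(unitaryGroupOfForm (conjLocal L (IsCMField.complexConj L) v) (cmLocalForm L 2 v))) * ((Ψ (γ₂, γ₁)).1 * (q.2 : ↥(unitaryGroupOfForm (conjLocal L (IsCMField.complexConj L) v) (cmLocalForm L 2 v)))) * (q.1 : ↥(unitaryGroupOfForm (conjLocal L (IsCMField.complexConj L) v) (cmLocalForm L 2 v)))⁻¹), (Ψ (γ₂, γ₁)).2) =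
        φ ((((q.1 : ↥(unitaryGroupOfForm (conjLocal L (IsCMField.complexConj L) v) (cmLocalForm L 2 v))) * ((t : ↥(unitaryGroupOfForm (conjLocal L (IsCMField.complexConj L) v) (cmLocalForm L 2 v))) * (q.2 : ↥(unitaryGroupOfForm (conjLocal L (IsCMField.complexConj L) v) (cmLocalForm L 2 v)))) * (q.1 : ↥(unitaryGroupOfForm (conjLocal L (IsCMField.complexConj L) v) (cmLocalForm L 2 v)))⁻¹ : ↥(unitaryGroupOfForm (conjLocal L (IsCMField.complexConj L) v) (cmLocalForm L 2 v))) : (cmDatum L 2 (Matrix.of fun i j : Fin 2 => if i.val + j.val + 1 = 2 then (1 : L) else 0)).Local v), u) := fun _ => rfl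
  simp only [hΨs1]
  congr 1
  -- `((a ∕ (κ₂U · κ₁U · m)) · J).toReal · κ₁U.toReal = ((a ∕ (κ₂U · m)) · J).toReal`
  rw [← ENNReal.toReal_mul]
  congr 1
  rw [mul_right_comm, show κ₂ Set.univ * κ₁ Set.univ * μN₂ {n | (n : ↥(unitaryGroupOfForm (conjLocal L (IsCMField.complexConj L) v) (cmLocalForm L 2 v))) ∈ K₂} = κ₁ Set.univ * (κ₂ Set.univ * μN₂ {n | (n : ↥(unitaryGroupOfForm (conjLocal L (IsCMField.complexConj L) v) (cmLocalForm L 2 v))) ∈ K₂}) by ring,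
    ENNReal.div_eq_inv_mul, ENNReal.div_eq_inv_mul, ENNReal.mul_inv (Or.inl hκ₁0) (Or.inl hκ₁top), mul_assoc, mul_assoc,
    mul_comm ((κ₁ Set.univ)⁻¹), mul_assoc, mul_assoc]
  congr 1
  rw [mul_left_comm _ (κ₁ Set.univ) _, ← mul_assoc, ENNReal.inv_mul_cancel hκ₁0 hκ₁top, one_mul]

end UnitaryGroup

end Literature.NumberTheory.Automorphic

end
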